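import Summits.NavierStokesRegularity.NavierStokesRegularity.Theorems.SoloInformedViscosityNormalisation

/-!
# Clay (A) ∨ Clay (C): the summit is the failure of the breakdown statement at one viscosity

Solo seat `solo-NavierStokesRegularity-informed` (new mathematics *about the summit statement*: a
normal form, not a substitute theorem). Fefferman's breakdown statement (C)
(`Literature.Analysis.FluidPDE.NavierStokesBreakdownR3`) asks, for EVERY `ν > 0`, for a Clay datum
`u₀` and a Clay-class force `f` admitting no smooth bounded-energy solution on `ℝ³ × [0,∞)`. Its
negation therefore only provides ONE viscosity `ν₀` at which every pair `(u₀, f)` is solvable; the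
`f = 0` slice of that is Clay (A) at the single viscosity `ν₀`, and the `ν`-normalisation
`navierStokesRegularity_of_fixedViscosity` (this seat, `SoloInformedViscosityNormalisation.lean`)
upgrades it to (A) at every viscosity, i.e. to the summit `NavierStokesRegularity`.

* `isSmoothOnHalfSpace_zero`, `hasRapidSpaceTimeDecay_zero`: the zero force is of Clay class (5), (6);
* `navierStokesRegularity_of_not_breakdownR3`: `¬ (C) → (A)`;
* `navierStokesRegularity_or_breakdownR3`: the dichotomy `(A) ∨ (C)` — exactly one viscosity-free
  bit of information separates the two printed Clay statements on `ℝ³`.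

(The uniform negation "(C) fails at every `ν`" is the registered strong hypothesis
`Literature.StrongHypotheses.NavierStokesRegularity.NavierStokesExistenceSmoothForcedR3`, which is
NOT used here; the point of this file is that the plain negation `¬ (C)` already suffices.)

References: C. L. Fefferman, Clay problem description, statements (A), (C) [cite: FeffermanClay2006,
(A) (C)]; T. Tao, *Localisation and compactness properties of the Navier–Stokes global regularity
problem*, Anal. PDE 6 (2013) = arXiv:1108.1165, footnote 3 [cite: Tao2011, footnote 3].
-/

open scoped ContDiff ENNReal
open MeasureTheory Set Function

namespace Summit.NavierStokesRegularity.NavierStokesRegularity.Theorems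

open Literature.Analysis.FluidPDE

variable {E : Type*} [NormedAddCommGroup E] [InnerProductSpace ℝ E] [FiniteDimensional ℝ E]
  {F : Type*} [NormedAddCommGroup F] [NormedSpace ℝ F]

omit [FiniteDimensional ℝ E] in
/-- The zero field is smooth on the closed half-space `E × [0,∞)` (Clay class (6)). [folklore] -/
theorem isSmoothOnHalfSpace_zero : IsSmoothOnHalfSpace (0 : ℝ → E → F) := by
  have h : Function.uncurry (0 : ℝ → E → F) = fun _ => 0 := by
    funext q; rfl
  rw [IsSmoothOnHalfSpace, h]
  exact contDiffOn_const

omit [FiniteDimensional ℝ E] in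
/-- The zero force has space-time rapid decay (Clay class (5)): every derivative vanishes.
[folklore] -/
theorem hasRapidSpaceTimeDecay_zero : HasRapidSpaceTimeDecay (0 : ℝ → E → F) := by
  intro n K
  have h : Function.uncurry (0 : ℝ → E → F) = 0 := by
    funext q; rfl
  refine ⟨0, fun t _ x => ?_⟩
  rw [h, iteratedFDerivWithin_zero]
  simp

/-- **`¬ (C) → (A)`.** If Fefferman's breakdown statement (C) on `ℝ³` fails, then the summit
`NavierStokesRegularity` (= Clay (A)) holds: the failure of (C) yields one viscosity `ν₀ > 0` at
which every Clay datum with every Clay-class force — in particular with `f = 0` — has a smooth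
bounded-energy solution, and Clay (A) at the single viscosity `ν₀` is the summit by the
`ν`-normalisation `navierStokesRegularity_of_fixedViscosity`.
[cite: FeffermanClay2006, (A) (C)] [cite: Tao2011, footnote 3] -/
theorem navierStokesRegularity_of_not_breakdownR3 (h : ¬ NavierStokesBreakdownR3) :
    NavierStokesRegularity := by
  by_contra hA
  refine h fun ν₀ hν₀ => ?_
  by_contra hC
  refine hA (navierStokesRegularity_of_fixedViscosity hν₀ fun u₀ hu₀ hdiv hdec => ?_)
  by_contra hno
  exact hC ⟨u₀, 0, hu₀, hdiv, hdec, isSmoothOnHalfSpace_zero, hasRapidSpaceTimeDecay_zero, hno⟩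

/-- **The Clay dichotomy on `ℝ³`: (A) ∨ (C).** At least one of Fefferman's two whole-space
statements holds — global smooth solutions for all Clay data at all viscosities (the summit), or
breakdown for some Clay datum and force at every viscosity. (Whether both can hold is open: that is
the question whether a Clay-class force can create a singularity that unforced data cannot, cf.
Tao 2013 after Prop. 1.7.) [cite: FeffermanClay2006, (A) (C)] -/
theorem navierStokesRegularity_or_breakdownR3 :
    NavierStokesRegularity ∨ NavierStokesBreakdownR3 :=
  or_iff_not_imp_right.mpr navierStokesRegularity_of_not_breakdownR3

end Summit.NavierStokesRegularity.NavierStokesRegularity.Theorems
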